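import Mathlib
import Literature.Computability.AlgebraicComplexity.GlynnMultilinearSigmaPiSigma
import Summits.ValiantsHypothesis.ValiantsHypothesis.Theorems.RigidityForcesSymmetryRankRigidMinimalReprBlockDefs

/-!
# The `3 × 3 × 3` block of a permutation — definitions for the three-tied-columns level count
# (crux `RankRigidMinimalRepr`, stmt-ValiantsHypothesis-18034, route `RigidityForcesSymmetry`; sequel of
# `…RankRigidMinimalReprBlockDefs.lean`)

For `σ ∈ 𝔖_{n+3}` put `p = σ⁻¹ 0`, `q = σ⁻¹ 1`, `r = σ⁻¹ 2` and, for columns `a, b, c`, let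
`tau₃ σ a b c = σ[p ↦ a, q ↦ b, r ↦ c]` be the self-map of `[n+3]` agreeing with `σ` off `{p, q, r}`.  For `a, b, c` TIED
(`≤ 2`, the three tied columns of `TiedLevelDecomposable m 2 s w`) the `27` graph monomials of `tau₃ σ a b c` form the
BLOCK of `σ`; the permanent's coefficients on the block are the PERMUTATION PATTERN (`coeff_tau₃_perPoly`: `1` iff
`a, b, c` are pairwise distinct), and for tied `a, b, c` the map `tau₃ σ a b c` hits an untied column `j` exactly where `σ`
does (`tau₃_eq_iff_of_untied`) and hits the tied columns exactly on `{p, q, r}` (`tau₃_val_le_two_iff`).  This is the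
`k = 2` analogue of `tau` (two tied columns, `…BlockDefs.lean`); the level count for three tied columns
(`…LevelBoundThreeTied.lean`) combines it with the tensor lemma `permPattern_three_not_two_slices`
(`…PermPatternThree.lean`).

Conventions as in `…BlockDefs.lean` (row = first coordinate, column = second; `Fin (n + 3)` so that the tied columns are
the numerals `0, 1, 2`).  HONEST FRAMING: definitions and elementary identities; nothing of the crux or of `VP ≠ VNP`.
-/

set_option autoImplicit false

-- the mandated summit-side namespace repeats a component by design (single-problem summit)
set_option linter.dupNamespace false

open MvPolynomial Finset
open Literature.Computability.AlgebraicComplexity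

namespace Summit.ValiantsHypothesis.ValiantsHypothesis.Theorems.RigidityForcesSymmetryRankRigidMinimalRepr

noncomputable section

variable {n : ℕ}

/-- For `σ ∈ 𝔖_{n+3}` with `p = σ⁻¹ 0`, `q = σ⁻¹ 1`, `r = σ⁻¹ 2`: the self-map `σ[p ↦ a, q ↦ b, r ↦ c]` of `[n+3]`. -/
def tau₃ (σ : Equiv.Perm (Fin (n + 3))) (a b c : Fin (n + 3)) : Fin (n + 3) → Fin (n + 3) :=
  fun x => if x = σ.symm 0 then a else if x = σ.symm 1 then b else if x = σ.symm 2 then c else σ x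

/-- `σ⁻¹ 0 ≠ σ⁻¹ 1`. -/
theorem symm_zero_ne_symm_one₃ (σ : Equiv.Perm (Fin (n + 3))) : σ.symm 0 ≠ σ.symm 1 := by
  intro h
  have := congrArg Fin.val (σ.symm.injective h)
  rw [Fin.val_zero, Fin.val_one] at this
  omega

/-- `σ⁻¹ 0 ≠ σ⁻¹ 2`. -/
theorem symm_zero_ne_symm_two₃ (σ : Equiv.Perm (Fin (n + 3))) : σ.symm 0 ≠ σ.symm 2 := by
  intro h
  have := congrArg Fin.val (σ.symm.injective h)
  rw [Fin.val_zero, Fin.val_two] at this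
  omega

/-- `σ⁻¹ 1 ≠ σ⁻¹ 2`. -/
theorem symm_one_ne_symm_two₃ (σ : Equiv.Perm (Fin (n + 3))) : σ.symm 1 ≠ σ.symm 2 := by
  intro h
  have := congrArg Fin.val (σ.symm.injective h)
  rw [Fin.val_one, Fin.val_two] at this
  omega

/-- Value of `σ[p ↦ a, q ↦ b, r ↦ c]` at `p`. -/
theorem tau₃_apply_symm_zero (σ : Equiv.Perm (Fin (n + 3))) (a b c : Fin (n + 3)) :
    tau₃ σ a b c (σ.symm 0) = a := by
  simp [tau₃]

/-- Value of `σ[p ↦ a, q ↦ b, r ↦ c]` at `q`. -/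
theorem tau₃_apply_symm_one (σ : Equiv.Perm (Fin (n + 3))) (a b c : Fin (n + 3)) :
    tau₃ σ a b c (σ.symm 1) = b := by
  simp [tau₃, (symm_zero_ne_symm_one₃ σ).symm]

/-- Value of `σ[p ↦ a, q ↦ b, r ↦ c]` at `r`. -/
theorem tau₃_apply_symm_two (σ : Equiv.Perm (Fin (n + 3))) (a b c : Fin (n + 3)) :
    tau₃ σ a b c (σ.symm 2) = c := by
  simp [tau₃, (symm_zero_ne_symm_two₃ σ).symm, (symm_one_ne_symm_two₃ σ).symm]

/-- Value of `σ[p ↦ a, q ↦ b, r ↦ c]` off `{p, q, r}`. -/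
theorem tau₃_apply_of_ne (σ : Equiv.Perm (Fin (n + 3))) (a b c : Fin (n + 3)) {x : Fin (n + 3)}
    (h0 : x ≠ σ.symm 0) (h1 : x ≠ σ.symm 1) (h2 : x ≠ σ.symm 2) : tau₃ σ a b c x = σ x := by
  simp [tau₃, h0, h1, h2]

/-- `σ x` is tied (`≤ 2`) iff `x ∈ {p, q, r}`. -/
theorem val_apply_le_two_iff (σ : Equiv.Perm (Fin (n + 3))) (x : Fin (n + 3)) :
    (σ x).val ≤ 2 ↔ x = σ.symm 0 ∨ x = σ.symm 1 ∨ x = σ.symm 2 := by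
  rw [Equiv.eq_symm_apply σ, Equiv.eq_symm_apply σ, Equiv.eq_symm_apply σ, Fin.ext_iff, Fin.ext_iff,
    Fin.ext_iff, Fin.val_zero, Fin.val_one, Fin.val_two]
  omega

/-- For `a, b, c` tied and `j` untied (`2 < j`): `σ[p ↦ a, q ↦ b, r ↦ c] x = j ↔ σ x = j`. -/
theorem tau₃_eq_iff_of_untied (σ : Equiv.Perm (Fin (n + 3))) {a b c j : Fin (n + 3)} (ha : a.val ≤ 2)
    (hb : b.val ≤ 2) (hc : c.val ≤ 2) (hj : 2 < j.val) (x : Fin (n + 3)) :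
    tau₃ σ a b c x = j ↔ σ x = j := by
  by_cases h0 : x = σ.symm 0
  · rw [h0, tau₃_apply_symm_zero, Equiv.apply_symm_apply]
    constructor
    · intro h; rw [← h] at hj; omega
    · intro h; rw [← h, Fin.val_zero] at hj; omega
  by_cases h1 : x = σ.symm 1
  · rw [h1, tau₃_apply_symm_one, Equiv.apply_symm_apply]
    constructor
    · intro h; rw [← h] at hj; omega
    · intro h; rw [← h, Fin.val_one] at hj; omega
  by_cases h2 : x = σ.symm 2
  · rw [h2, tau₃_apply_symm_two, Equiv.apply_symm_apply]
    constructor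
    · intro h; rw [← h] at hj; omega
    · intro h; rw [← h, Fin.val_two] at hj; omega
  rw [tau₃_apply_of_ne σ a b c h0 h1 h2]

/-- For `a, b, c` tied: `σ[p ↦ a, q ↦ b, r ↦ c] x` is tied iff `x ∈ {p, q, r}`. -/
theorem tau₃_val_le_two_iff (σ : Equiv.Perm (Fin (n + 3))) {a b c : Fin (n + 3)} (ha : a.val ≤ 2)
    (hb : b.val ≤ 2) (hc : c.val ≤ 2) (x : Fin (n + 3)) :
    (tau₃ σ a b c x).val ≤ 2 ↔ x = σ.symm 0 ∨ x = σ.symm 1 ∨ x = σ.symm 2 := by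
  by_cases h0 : x = σ.symm 0
  · rw [h0, tau₃_apply_symm_zero]; exact ⟨fun _ => Or.inl rfl, fun _ => ha⟩
  by_cases h1 : x = σ.symm 1
  · rw [h1, tau₃_apply_symm_one]; exact ⟨fun _ => Or.inr (Or.inl rfl), fun _ => hb⟩
  by_cases h2 : x = σ.symm 2
  · rw [h2, tau₃_apply_symm_two]; exact ⟨fun _ => Or.inr (Or.inr rfl), fun _ => hc⟩
  rw [tau₃_apply_of_ne σ a b c h0 h1 h2, val_apply_le_two_iff]

/-- For tied `a, b, c`: `σ[p ↦ a, q ↦ b, r ↦ c]` is injective iff `a, b, c` are pairwise distinct. -/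
theorem injective_tau₃_iff (σ : Equiv.Perm (Fin (n + 3))) {a b c : Fin (n + 3)} (ha : a.val ≤ 2)
    (hb : b.val ≤ 2) (hc : c.val ≤ 2) :
    Function.Injective (tau₃ σ a b c) ↔ (a ≠ b ∧ a ≠ c ∧ b ≠ c) := by
  constructor
  · intro hinj
    refine ⟨fun h => symm_zero_ne_symm_one₃ σ (hinj ?_), fun h => symm_zero_ne_symm_two₃ σ (hinj ?_),
      fun h => symm_one_ne_symm_two₃ σ (hinj ?_)⟩
    · rw [tau₃_apply_symm_zero, tau₃_apply_symm_one]; exact h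
    · rw [tau₃_apply_symm_zero, tau₃_apply_symm_two]; exact h
    · rw [tau₃_apply_symm_one, tau₃_apply_symm_two]; exact h
  · rintro ⟨hab, hac, hbc⟩ x y hxy
    -- the tied values are taken exactly on `{p, q, r}`, injectively; off it `tau₃ = σ`
    have tied : ∀ z, (tau₃ σ a b c z).val ≤ 2 ↔ z = σ.symm 0 ∨ z = σ.symm 1 ∨ z = σ.symm 2 :=
      tau₃_val_le_two_iff σ ha hb hc
    by_cases hx : x = σ.symm 0 ∨ x = σ.symm 1 ∨ x = σ.symm 2
    · have hy : y = σ.symm 0 ∨ y = σ.symm 1 ∨ y = σ.symm 2 := by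
        rw [← tied, ← hxy, tied]; exact hx
      rcases hx with rfl | rfl | rfl <;> rcases hy with rfl | rfl | rfl <;>
        simp only [tau₃_apply_symm_zero, tau₃_apply_symm_one, tau₃_apply_symm_two] at hxy
      all_goals first
        | rfl
        | exact absurd hxy hab
        | exact absurd hxy.symm hab
        | exact absurd hxy hac
        | exact absurd hxy.symm hac
        | exact absurd hxy hbc
        | exact absurd hxy.symm hbc
    · have hy : ¬ (y = σ.symm 0 ∨ y = σ.symm 1 ∨ y = σ.symm 2) := by
        rw [← tied, ← hxy, tied]; exact hx
      push Not at hx hy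
      rw [tau₃_apply_of_ne σ a b c hx.1 hx.2.1 hx.2.2, tau₃_apply_of_ne σ a b c hy.1 hy.2.1 hy.2.2] at hxy
      exact σ.injective hxy

/-- **The permanent on the `3 × 3 × 3` block is the permutation pattern**: for tied `a, b, c` the coefficient of
the graph monomial of `σ[p ↦ a, q ↦ b, r ↦ c]` in `perm_{n+3}` is `1` if `a, b, c` are pairwise distinct and `0`
otherwise (tree `coeff_graphMonomial_perPoly`: the coefficient is `[bijective]`). -/
theorem coeff_tau₃_perPoly (σ : Equiv.Perm (Fin (n + 3))) {a b c : Fin (n + 3)} (ha : a.val ≤ 2)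
    (hb : b.val ≤ 2) (hc : c.val ≤ 2) :
    coeff (graphMonomial (tau₃ σ a b c)) (perPoly (Fin (n + 3)) ℂ) =
      if a ≠ b ∧ a ≠ c ∧ b ≠ c then 1 else 0 := by
  rw [coeff_graphMonomial_perPoly]
  by_cases h : a ≠ b ∧ a ≠ c ∧ b ≠ c
  · rw [if_pos h, if_pos ((injective_tau₃_iff σ ha hb hc).2 h).bijective_of_finite]
  · rw [if_neg h, if_neg (fun hbij => h ((injective_tau₃_iff σ ha hb hc).1 hbij.1))]

end

end Summit.ValiantsHypothesis.ValiantsHypothesis.Theorems.RigidityForcesSymmetryRankRigidMinimalRepr
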